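import Mathlib
import Summits.ValiantsHypothesis.ValiantsHypothesis.Theses.BarrierLever
import Summits.ValiantsHypothesis.ValiantsHypothesis.Theorems.BarrierLeverDefinableDcEquationsBalancedStrength
import Summits.ValiantsHypothesis.ValiantsHypothesis.Theorems.BarrierLeverDefinableEquationsDegreeWindow
import Summits.ValiantsHypothesis.ValiantsHypothesis.Theorems.BarrierLeverDefinableEquationsDegreeWindowThin
import HarnessLib

/-!
# Route decl `BarrierLever.DefinableDcEquations` (stmt-8746) — the degree-window door for the
# DETERMINANTAL slice: a window of POLYLOGARITHMIC degree `d(n) = (log₂ n + 1)³` (val-np-p5 g22)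

The degree-window door for the crux at size exponent `b` (`…DegreeWindow.lean`,
`…DegreeWindowDoor.lean`) lives in a window of CONSTANT degree `d(b)`.  Item 8746
(`DefinableDcEquations`: level-`a` Boolean-sum equations for the slice
`{deg f ≤ n, dc f ≤ m(n)}` with `m(n) ≥ 2^{C (log₂ n+1)²}` for every `C` eventually) has a class
of QUASI-POLYNOMIAL circuit size (`dc f ≤ m ⇒ L(f) ≤ 8(m+1)^7 + m²(2n+1)`, Berkowitz; with the
admissible threshold `m(n) = 2^{(log₂ n+1)³}` of gen 21: `L(f) ≤ 2^{8(log₂ n+1)³}`), so no window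
of constant degree is thin for it; but a window of POLYLOGARITHMIC degree is:

* §1 `homogeneousComponent_mem_forms_of_dc`, `homogeneousComponent_mem_forms_log3` — for
  `dc f ≤ 2^{(log₂ n+1)³}` (`n ≥ 4`), `hom_d f` is a degree-`d` FORM of size
  `≤ (d+2)² · 2^{8(log₂ n+1)³}`;
* §2 **`definableDcEquations_of_window_equations`** — THE DOOR: if for some level `a`,
  eventually in `n`, there are a degree `d ≤ n` (free to depend on `n`) and a level-`a` Boolean-sum
  datum in the `C(n+d-1,d)` degree-`d` window variables with NONZERO Boolean sum vanishing at
  `coeff_d(g)` for every degree-`d` form `g` of size `≤ (d+2)² · 2^{8(log₂ n+1)³}`, then the ROUTE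
  DECL `DefinableDcEquations` holds (hence `DefinableEquations` (8745) and `SingleSizeEquations`
  (8749) by the tree's reductions);
* §3 `dcWindow_count` (the arithmetic: `u = log₂ n + 1 ≥ 19`, `u⁶ ≤ 2^u`, `2^{u-1} ≤ n` ⇒
  `4 (d+2)² 2^{8u³} + 1 < C(n+d-1, d)` for `d = u³`), `dcWindow_degree_le`,
  **`exists_dcWindowEquation_eventually`** — eventually in `n` the door's class at
  `d(n) = (log₂ n+1)³` carries a NONZERO (non-explicit) window equation (constant count, sibling
  `exists_windowEquation`): the 8746 window door is not vacuous in degree `(log₂ n + 1)³`, ambient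
  dimension `C(n+d-1,d) = n^{Θ(log³ n)}` (quasi-polynomial), budget `N^a = 2^{Θ(n)}` still
  exponential in it.

Honest framing: a DOOR (sufficient, not equivalent); 8746 stays OPEN, 8745/8749 OPEN at `b = 2`
(Chatterjee–Tengse 2023 §1.3 dir. 2); nothing on crux 14610 or `VP ≠ VNP`, which is NOT proved.
No definitions, no named facts; standard axioms.

References: Forbes–Shpilka–Volk 2018, Def. 1; Bürgisser 2000, Rem. 2.7 (Berkowitz);
Bürgisser–Clausen–Shokrollahi 1997, Lemma (21.25), Thm. (9.13).
-/

set_option linter.dupNamespace false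

noncomputable section

namespace Summit.ValiantsHypothesis.ValiantsHypothesis.Theorems.BarrierLeverDefinableEquations

open MvPolynomial
open Literature.Computability.AlgebraicComplexity Literature.Barriers.ValiantsHypothesis
open Summit.ValiantsHypothesis.Theorems.DetqpThesis.Negative (complexity_le_of_determinantalComplexity)
open scoped BigOperators

namespace DegreeWindow

/-! ## §1 The window of the determinantal slice is a class of forms of quasi-polynomial size -/

/-- `dc f ≤ m ⇒ hom_d f` is a degree-`d` form of size `≤ (d+2)² (8(m+1)^7 + m²(2n+1))` (Berkowitz
for `f`, then BCS Lemma 21.25 for the component). [cite: Burgisser2000, Rem. 2.7] -/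
theorem homogeneousComponent_mem_forms_of_dc {n m d : ℕ} {f : MvPolynomial (Fin n) ℂ}
    (hdc : determinantalComplexity f ≤ m) :
    (homogeneousComponent d f).IsHomogeneous d ∧
      complexity (homogeneousComponent d f) ≤ (d + 2) ^ 2 * (8 * (m + 1) ^ 7 + m ^ 2 * (2 * n + 1)) := by
  refine ⟨homogeneousComponent_isHomogeneous d f,
    (complexity_homogeneousComponent_le_sq_mul f d).trans (Nat.mul_le_mul_left _ ?_)⟩
  refine (complexity_le_of_determinantalComplexity f).trans ?_
  rw [Fintype.card_fin]
  have h7 : (determinantalComplexity f + 1) ^ 7 ≤ (m + 1) ^ 7 := Nat.pow_le_pow_left (by omega) 7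
  have h2 : determinantalComplexity f ^ 2 ≤ m ^ 2 := Nat.pow_le_pow_left hdc 2
  exact Nat.add_le_add (Nat.mul_le_mul_left _ h7) (Nat.mul_le_mul_right _ h2)

/-- With the admissible threshold `m(n) = 2^{(log₂ n+1)³}` (`n ≥ 4`): `hom_d f` is a degree-`d`
form of size `≤ (d+2)² · 2^{8(log₂ n+1)³}` (gen 21's `BalancedStrength.size_le_two_pow`).
[cite: Burgisser2000, Rem. 2.7] -/
theorem homogeneousComponent_mem_forms_log3 {n d : ℕ} (hn : 4 ≤ n) {f : MvPolynomial (Fin n) ℂ}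
    (hdc : determinantalComplexity f ≤ 2 ^ ((Nat.log 2 n + 1) ^ 3)) :
    (homogeneousComponent d f).IsHomogeneous d ∧
      complexity (homogeneousComponent d f) ≤ (d + 2) ^ 2 * 2 ^ (8 * (Nat.log 2 n + 1) ^ 3) := by
  obtain ⟨h1, h2⟩ := homogeneousComponent_mem_forms_of_dc (d := d) hdc
  refine ⟨h1, h2.trans (Nat.mul_le_mul_left _ ?_)⟩
  have ht : 2 ≤ Nat.log 2 n := Nat.le_log_of_pow_le (by norm_num) (by omega)
  have hlt : n < 2 ^ (Nat.log 2 n + 1) := Nat.lt_pow_succ_log_self (by norm_num) n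
  have hsz := BalancedStrength.size_le_two_pow ht hlt
  set S := 8 * (2 ^ ((Nat.log 2 n + 1) ^ 3) + 1) ^ 7 +
    (2 ^ ((Nat.log 2 n + 1) ^ 3)) ^ 2 * (2 * n + 1) with hS
  have h4 : 1 ≤ 4 * (n + 1) ^ 2 := by nlinarith
  calc S = S * 1 := (mul_one S).symm
    _ ≤ S * (4 * (n + 1) ^ 2) := Nat.mul_le_mul_left _ h4
    _ = 4 * S * (n + 1) ^ 2 := by ring
    _ ≤ 4 * S * (n + 1) ^ 2 + 1 := Nat.le_succ _
    _ ≤ 2 ^ (8 * (Nat.log 2 n + 1) ^ 3) := hsz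

/-! ## §2 The door for `DefinableDcEquations` through a window -/

/-- **THE DEGREE-WINDOW DOOR FOR 8746.**  If for some level `a`, eventually in `n`, there are a
degree `d ≤ n` and a level-`a` Boolean-sum datum in the degree-`d` window variables (`q ≤ N^a`
Boolean variables, complexity and degree `≤ N^a`, `N = C(2n,n)`) whose NONZERO Boolean sum vanishes
at `coeff_d(g)` for every degree-`d` form `g` of size `≤ (d+2)² · 2^{8(log₂ n+1)³}`, then
`BarrierLever.DefinableDcEquations` (stmt-ValiantsHypothesis-8746) holds, with the admissible
threshold `m(n) = 2^{(log₂ n+1)³}`. [cite: ForbesShpilkaVolk2018, Def. 1] -/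
theorem definableDcEquations_of_window_equations
    (hE : ∃ a n₀ : ℕ, ∀ n ≥ n₀, ∃ d : ℕ, d ≤ n ∧ ∃ q : ℕ, q ≤ (Nat.choose (2 * n) n) ^ a ∧
      ∃ H' : MvPolynomial (GKSS2017.homMonomials n d ⊕ Fin q) ℂ,
        complexity H' ≤ (Nat.choose (2 * n) n) ^ a ∧ H'.totalDegree ≤ (Nat.choose (2 * n) n) ^ a ∧
        boolSum H' ≠ 0 ∧
        ∀ g : MvPolynomial (Fin n) ℂ, g.IsHomogeneous d →
          complexity g ≤ (d + 2) ^ 2 * 2 ^ (8 * (Nat.log 2 n + 1) ^ 3) →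
          eval (coeffVector (GKSS2017.homMonomials n d) g) (boolSum H') = 0) :
    Summit.ValiantsHypothesis.ValiantsHypothesis.Theses.BarrierLever.DefinableDcEquations := by
  obtain ⟨a, n₀, h⟩ := hE
  refine ⟨fun n => 2 ^ ((Nat.log 2 n + 1) ^ 3), BalancedStrength.threshold_admissible, a,
    max n₀ 4, fun n hn => ?_⟩
  obtain ⟨d, hdn, q, hq, H', hc, hdeg, hne, hvan⟩ := h n (le_of_max_le_left hn)
  obtain ⟨H, hHc, hHd, hHne, hHeval⟩ := exists_datum_of_windowDatum hdn H' hc hdeg hne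
  refine ⟨q, hq, H, hHc, hHd, hHne, fun f _hfdeg hfdc => ?_⟩
  rw [hHeval f, coeffVector_homMonomials_eq_homogeneousComponent]
  obtain ⟨hhom, hsize⟩ := homogeneousComponent_mem_forms_log3 (d := d) (le_of_max_le_right hn) hfdc
  exact hvan _ hhom hsize

/-! ## §3 Non-vacuity in polylogarithmic degree `d(n) = (log₂ n + 1)³` -/

/-- **The count.** For `u ≥ 19` with `u⁶ ≤ 2^u`, `2^{u-1} ≤ n` and `d = u³`:
`4 (d+2)² 2^{8u³} + 1 < C(n+d-1, d)` (via `d!·(4(d+2)²2^{8u³}+2) ≤ 2^{(u-1)d} ≤ n^d ≤ d!·C(n+d-1,d)`,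
the middle inequality squared: `(d!)² ≤ d^{2d} ≤ 2^{ud}`, `(4(d+2)²Y+2)² ≤ 2^{8+2u+16u³}`, and
`ud + 16u³ + 2u + 8 ≤ 2(u-1)d` iff `18u³ + 2u + 8 ≤ u⁴`). [folklore] -/
theorem dcWindow_count {u n : ℕ} (hu : 19 ≤ u) (hu6 : u ^ 6 ≤ 2 ^ u) (hn : 2 ^ (u - 1) ≤ n) :
    4 * ((u ^ 3 + 2) ^ 2 * 2 ^ (8 * u ^ 3)) + 1 < (n + u ^ 3 - 1).choose (u ^ 3) := by
  set d := u ^ 3 with hd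
  set Y := 2 ^ (8 * u ^ 3) with hY
  have hd5 : 5 ≤ d := le_trans (by norm_num) (Nat.pow_le_pow_left hu 3)
  have hY1 : 1 ≤ Y := Nat.one_le_two_pow
  -- `d² ≤ 2^u`
  have hd2 : d ^ 2 ≤ 2 ^ u := by rw [hd, ← pow_mul]; exact hu6
  -- the factor `X = 4(d+2)²Y + 2 ≤ 16 d² Y`
  have hX : 4 * ((d + 2) ^ 2 * Y) + 2 ≤ 16 * d ^ 2 * Y := by
    have h1 : (d + 2) ^ 2 ≤ 2 * d ^ 2 := by nlinarith
    have h2 : 2 ≤ 8 * d ^ 2 * Y := by nlinarith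
    nlinarith
  -- squares: `(d! · X)² ≤ 2^{ud} · 2^{2u+8} · Y²`
  have hfac : d.factorial ≤ d ^ d := Nat.factorial_le_pow d
  have hfac2 : d.factorial ^ 2 ≤ 2 ^ (u * d) := by
    calc d.factorial ^ 2 ≤ (d ^ d) ^ 2 := Nat.pow_le_pow_left hfac 2
      _ = (d ^ 2) ^ d := pow_right_comm d d 2
      _ ≤ (2 ^ u) ^ d := Nat.pow_le_pow_left hd2 d
      _ = 2 ^ (u * d) := by rw [← pow_mul]
  have hX2 : (4 * ((d + 2) ^ 2 * Y) + 2) ^ 2 ≤ 2 ^ (2 * u + 8) * Y ^ 2 := by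
    calc (4 * ((d + 2) ^ 2 * Y) + 2) ^ 2 ≤ (16 * d ^ 2 * Y) ^ 2 := Nat.pow_le_pow_left hX 2
      _ = 256 * (d ^ 2) ^ 2 * Y ^ 2 := by ring
      _ ≤ 256 * (2 ^ u) ^ 2 * Y ^ 2 := by gcongr
      _ = 2 ^ (2 * u + 8) * Y ^ 2 := by
          rw [show (256 : ℕ) = 2 ^ 8 by norm_num, ← pow_mul, ← pow_add]; ring_nf
  have hY2 : Y ^ 2 = 2 ^ (16 * u ^ 3) := by rw [hY, ← pow_mul]; ring_nf
  -- exponent bookkeeping: `u d + 2u + 8 + 16 u³ ≤ 2 (u-1) d`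
  have hexp : u * d + (2 * u + 8) + 16 * u ^ 3 ≤ 2 * ((u - 1) * d) := by
    have hu4 : 19 * u ^ 3 ≤ u ^ 4 := by
      calc 19 * u ^ 3 ≤ u * u ^ 3 := Nat.mul_le_mul_right _ hu
        _ = u ^ 4 := by ring
    have hsmall : 2 * u + 8 ≤ u ^ 3 := by
      have h19 : 19 * 19 * u ≤ u ^ 3 := by
        calc 19 * 19 * u ≤ u * u * u := by gcongr
          _ = u ^ 3 := by ring
      omega
    have hkey : 18 * u ^ 3 + (2 * u + 8) ≤ u ^ 4 := by omega
    have h1 : 1 ≤ u := by omega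
    -- `2 (u-1) d = 2 u d - 2 d`, `u d = u⁴`
    have hud : u * d = u ^ 4 := by rw [hd]; ring
    zify [h1] at hkey hud ⊢
    nlinarith [hkey, hud]
  have hsq : (d.factorial * (4 * ((d + 2) ^ 2 * Y) + 2)) ^ 2 ≤ (2 ^ ((u - 1) * d)) ^ 2 := by
    calc (d.factorial * (4 * ((d + 2) ^ 2 * Y) + 2)) ^ 2
        = d.factorial ^ 2 * (4 * ((d + 2) ^ 2 * Y) + 2) ^ 2 := by ring
      _ ≤ 2 ^ (u * d) * (2 ^ (2 * u + 8) * Y ^ 2) := Nat.mul_le_mul hfac2 hX2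
      _ = 2 ^ (u * d + (2 * u + 8) + 16 * u ^ 3) := by rw [hY2, ← pow_add, ← pow_add]; ring
      _ ≤ 2 ^ (2 * ((u - 1) * d)) := Nat.pow_le_pow_right (by norm_num) hexp
      _ = (2 ^ ((u - 1) * d)) ^ 2 := by rw [← pow_mul, mul_comm]
  have hmain : d.factorial * (4 * ((d + 2) ^ 2 * Y) + 2) ≤ 2 ^ ((u - 1) * d) :=
    (Nat.pow_le_pow_iff_left (by norm_num : (2 : ℕ) ≠ 0)).mp hsq
  -- `2^{(u-1) d} ≤ n^d ≤ d! · C(n+d-1, d)`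
  have hnd : 2 ^ ((u - 1) * d) ≤ n ^ d := by
    rw [pow_mul]; exact Nat.pow_le_pow_left hn d
  have hch := pow_le_factorial_mul_choose n d
  have hlt : d.factorial * (4 * ((d + 2) ^ 2 * Y) + 1) < d.factorial * (n + d - 1).choose d := by
    have hfpos : 0 < d.factorial := Nat.factorial_pos d
    calc d.factorial * (4 * ((d + 2) ^ 2 * Y) + 1)
        < d.factorial * (4 * ((d + 2) ^ 2 * Y) + 2) := Nat.mul_lt_mul_of_pos_left (by omega) hfpos
      _ ≤ d.factorial * (n + d - 1).choose d := hmain.trans (hnd.trans hch)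
  exact Nat.lt_of_mul_lt_mul_left hlt

/-- Degree bookkeeping: under the same hypotheses `d = u³ ≤ n`. [folklore] -/
theorem dcWindow_degree_le {u n : ℕ} (hu : 19 ≤ u) (hu6 : u ^ 6 ≤ 2 ^ u) (hn : 2 ^ (u - 1) ≤ n) :
    u ^ 3 ≤ n := by
  refine le_trans ?_ hn
  -- `u³ · u³ ≤ 2^u = 2 · 2^{u-1}` and `u³ ≥ 2`
  have h6 : u ^ 3 * u ^ 3 ≤ 2 * 2 ^ (u - 1) := by
    rw [← pow_add, show 3 + 3 = 6 by norm_num, ← pow_succ']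
    rwa [show u - 1 + 1 = u by omega]
  have h2 : 2 ≤ u ^ 3 := le_trans (by norm_num) (Nat.pow_le_pow_left (show 2 ≤ u by omega) 3)
  nlinarith

/-- **The 8746 window door is not vacuous in degree `(log₂ n + 1)³`.**  Eventually in `n`, with
`d = (log₂ n + 1)³ ≤ n`, a NONZERO polynomial in the `C(n+d-1,d)` degree-`d` window variables
vanishes at `coeff_d(g)` for every `g` of circuit size `≤ (d+2)² · 2^{8(log₂ n+1)³}` — in
particular on the door's class of degree-`d` forms of that size, and at `coeff_d(f)` for every `f`
of the slice `dc f ≤ 2^{(log₂ n+1)³}` (constant count, sibling `exists_windowEquation`; not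
explicit). [cite: BurgisserClausenShokrollahi1997, Thm. (9.13)] -/
theorem exists_dcWindowEquation_eventually : ∃ n₀ : ℕ, ∀ n ≥ n₀,
    (Nat.log 2 n + 1) ^ 3 ≤ n ∧
    ∃ E : MvPolynomial (GKSS2017.homMonomials n ((Nat.log 2 n + 1) ^ 3)) ℂ, E ≠ 0 ∧
      (∀ g : MvPolynomial (Fin n) ℂ,
        complexity g ≤ ((Nat.log 2 n + 1) ^ 3 + 2) ^ 2 * 2 ^ (8 * (Nat.log 2 n + 1) ^ 3) →
        eval (coeffVector (GKSS2017.homMonomials n ((Nat.log 2 n + 1) ^ 3)) g) E = 0) ∧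
      (4 ≤ n → ∀ f : MvPolynomial (Fin n) ℂ,
        determinantalComplexity f ≤ 2 ^ ((Nat.log 2 n + 1) ^ 3) →
        eval (coeffVector (GKSS2017.homMonomials n ((Nat.log 2 n + 1) ^ 3)) f) E = 0) := by
  obtain ⟨m₀, hm₀⟩ := BalancedStrength.eventually_mul_pow_lt_two_pow 6 1
  refine ⟨2 ^ (max m₀ 19), fun n hn => ?_⟩
  set u := Nat.log 2 n + 1 with hudef
  have hlog : max m₀ 19 ≤ Nat.log 2 n := by
    have := Nat.log_mono_right (b := 2) hn
    rwa [Nat.log_pow (by norm_num)] at this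
  have hu : 19 ≤ u := by have := le_of_max_le_right hlog; omega
  have hu6 : u ^ 6 ≤ 2 ^ u := by
    have := hm₀ u (by have := le_of_max_le_left hlog; omega)
    omega
  have hn1 : n ≠ 0 := by
    have : 1 ≤ 2 ^ (max m₀ 19) := Nat.one_le_two_pow
    omega
  have hn2 : 2 ^ (u - 1) ≤ n := by
    rw [hudef, Nat.add_sub_cancel]
    exact Nat.pow_log_le_self 2 hn1
  obtain ⟨E, hE0, hE⟩ := exists_windowEquation (n := n) (d := u ^ 3) (dcWindow_count hu hu6 hn2)
  refine ⟨dcWindow_degree_le hu hu6 hn2, E, hE0, hE, fun h4 f hfdc => ?_⟩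
  rw [coeffVector_homMonomials_eq_homogeneousComponent]
  exact hE _ (homogeneousComponent_mem_forms_log3 (d := u ^ 3) h4 hfdc).2

end DegreeWindow

end Summit.ValiantsHypothesis.ValiantsHypothesis.Theorems.BarrierLeverDefinableEquations
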